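import Literature.NumberTheory.Sieve.MaynardSieveBilinear
import Literature.NumberTheory.Sieve.MaynardSieveWeightsM
import Literature.NumberTheory.Sieve.SmoothMajorantLocal
import HarnessLib

/-!
# The Maynard–Tao sieve: `y^{(m)}` in terms of `y` (Maynard 2015, Lemma 5.3)

Topic `Literature/NumberTheory/Sieve`; sequel of `MaynardSieveBilinear.lean` (which defines, for an
arbitrary function `y` on `k`-tuples supported on the good tuples of a box `[1, B]^k`, Maynard's
weights `lam B y = λ` ((5.10)) and variables `ym W B y m = y^{(m)}` ((5.21))) and of
`MaynardSieveWeightsM.lean` (which treats the EXACT part of Lemma 5.3 for `λ = maynardWeight`: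
`maynardYm_eq_sum`, `maynardYm_eq_ym : maynardYm = MaynardSieve.ym … (maynardY …)`, and the
one-variable core `Literature.NumberTheory.Sieve.sum_divisors_moebius_mul_idDivTotient`, reused here; its header records that
"the error estimate of Lemma 5.3 … is NOT treated" there — that estimate is this file). This file proves
J. Maynard, *Small gaps between primes*, Ann. of Math. 181 (2015), **Lemma 5.3**:
for `r_m = 1`,
`y^{(m)}_{r} = Σ_{a} y_{r₁,…,r_{m−1},a,r_{m+1},…,r_k}/φ(a) + O(y_max φ(W) log R/(W D₀))`,
in the following explicit form. For `W` even, `y` supported on good tuples of `[1,B]^k` with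
`|y| ≤ y_max`, and a good `u` with `u_m = 1`:

* `ym_eq_sum` — the exact identity (5.27)–(5.29):
  `y^{(m)}_u = (∏ μ(uᵢ)g(uᵢ)) Σ_{r good} (y_r/∏φ(rᵢ)) ∏_{i ≠ m} [uᵢ ∣ rᵢ] h(uᵢ) V(rᵢ/uᵢ)`,
  `h(d) = μ(d) d/φ(d)` (`hAF`), `V(n) = Σ_{e∣n} h(e) = ∏_{p∣n} (−1/(p−1))` (`Vsum`, `sum_divisors_hAF`);
* `prefactor_mul_sum_main_eq` — the tuples `r = u[m ↦ a]` contribute exactly `κ(u) · M(u)`,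
  `M(u) = Σ_{1 ≤ a ≤ B} y_{u[m↦a]}/φ(a)` (`Mterm`), `κ(u) = ∏ᵢ g(uᵢ)uᵢ/φ(uᵢ)²` (`kappa`, the product
  of (5.31));
* `abs_ym_sub_main_le` — **Lemma 5.3**:
  `|y^{(m)}_u − κ(u) M(u)| ≤ y_max κ(u) · k L (Z − 1) Z^k`, `L = Σ_{n ≤ B good} 1/φ(n)`,
  `Z = Σ_{n ≤ B good} 1/φ(n)²` — Maynard's (5.30) (`≪ y_max φ(W) log R/(W D₀)`: there `L ≪ φ(W) log R/W`
  and `Z − 1 ≪ 1/D₀` since good `n > 1` exceed `D₀`); the error terms are bounded termwise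
  (`abs_rest_term_le`, `|h(u)| = u/φ(u)`, `|V(n)| = 1/φ(n)`), reindexed by `t = r/u`
  (`sum_rest_wfun_le`) and summed coordinatewise (`sum_wfun_filter_le`);
* `ym_eq_zero_of_ne` (`y^{(m)}_u = 0` unless `u_m = 1`), `abs_Mterm_le` (`|M(u)| ≤ y_max L`);
* the size of `κ`: `kappa_le_one` and `one_sub_le_kappa`: `1 − k/(D₀ − 1) ≤ κ(u) ≤ 1` when every
  prime `≤ D₀` divides `W` (Maynard: "the product … may be replaced by `1 + O(D₀⁻¹)`"), via
  `g(n)n/φ(n)² = ∏_{p∣n}(1 − 1/(p−1)²)` (`gAF_mul_div_sq_eq`), the Weierstrass inequality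
  `1 − Σxᵢ ≤ ∏(1 − xᵢ)` (the tree's `Literature.NumberTheory.Sieve.CFZ.one_sub_sum_le_prod_one_sub`) and `Σ_{p∣n} 1/(p−1)² ≤ 1/(D₀−1)` (Mathlib's `sum_Ioc_inv_sq_le_sub`).

## References

* J. Maynard, *Small gaps between primes*, Ann. of Math. (2) 181 (2015), 383–413,
  doi:10.4007/annals.2015.181.1.7 = arXiv:1311.4600v3, Lemma 5.3 and its proof, (5.27)–(5.31).
  [cite: MaynardAnnals2015]
-/

open Finset Real ArithmeticFunction

open scoped ArithmeticFunction.Moebius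

namespace Literature.NumberTheory.Sieve

namespace MaynardSieve

variable {k : ℕ}

/-! ### Multiplicative sums over the interval `[u, r]` of the divisor lattice -/

/-- For `f` multiplicative, `r` squarefree and `u ∣ r`: `Σ_{u ∣ d ∣ r} f(d) = f(u) Σ_{e ∣ r/u} f(e)`
(`d = u e` with `(u, e) = 1`). [folklore] -/
theorem sum_divisors_filter_dvd_of_isMultiplicative {f : ArithmeticFunction ℝ}
    (hf : f.IsMultiplicative) {u r : ℕ} (hr : Squarefree r) (hu : u ∣ r) :
    ∑ d ∈ r.divisors with u ∣ d, f d = f u * ∑ e ∈ (r / u).divisors, f e := by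
  have hr0 : r ≠ 0 := hr.ne_zero
  have hu0 : u ≠ 0 := fun h => hr0 (by rw [h] at hu; exact zero_dvd_iff.1 hu)
  obtain ⟨t, rfl⟩ := hu
  have ht0 : t ≠ 0 := fun h => hr0 (by rw [h, mul_zero])
  rw [Nat.mul_div_cancel_left t (Nat.pos_of_ne_zero hu0)]
  have hre : ∑ d ∈ (u * t).divisors with u ∣ d, f d = ∑ e ∈ t.divisors, f (u * e) := by
    symm
    refine Finset.sum_nbij (fun e => u * e) (fun e he => ?_) (fun e₁ he₁ e₂ he₂ h => ?_)
      (fun d hd => ?_) (fun e he => rfl)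
    · rw [Finset.mem_filter, Nat.mem_divisors]
      exact ⟨⟨mul_dvd_mul_left u (Nat.dvd_of_mem_divisors he), mul_ne_zero hu0 ht0⟩,
        dvd_mul_right u e⟩
    · exact Nat.eq_of_mul_eq_mul_left (Nat.pos_of_ne_zero hu0) h
    · rw [Finset.mem_coe, Finset.mem_filter, Nat.mem_divisors] at hd
      obtain ⟨⟨hd, -⟩, ⟨e, rfl⟩⟩ := hd
      refine ⟨e, ?_, rfl⟩
      rw [Finset.mem_coe, Nat.mem_divisors]
      exact ⟨Nat.dvd_of_mul_dvd_mul_left (Nat.pos_of_ne_zero hu0) hd, ht0⟩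
  rw [hre, Finset.mul_sum]
  refine Finset.sum_congr rfl fun e he => ?_
  have hcop : u.Coprime e := Nat.coprime_of_squarefree_mul
    (hr.squarefree_of_dvd (mul_dvd_mul_left u (Nat.dvd_of_mem_divisors he)))
  rw [hf.map_mul_of_coprime hcop]

/-- Maynard's auxiliary multiplicative function `h(d) = μ(d) d / φ(d)` (the summand of the
`d`-sum in (5.28)). [cite: MaynardAnnals2015, (5.28)] -/
noncomputable def hAF : ArithmeticFunction ℝ :=
  ⟨fun n => ((μ n : ℤ) : ℝ) * (n : ℝ) / (n.totient : ℝ), by simp⟩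

/-- Unfolding `hAF`. [folklore] -/
theorem hAF_apply (n : ℕ) : hAF n = ((μ n : ℤ) : ℝ) * (n : ℝ) / (n.totient : ℝ) := rfl

/-- `h` is multiplicative. [folklore] -/
theorem isMultiplicative_hAF : hAF.IsMultiplicative := by
  refine ⟨by simp [hAF_apply], fun {m n} hmn => ?_⟩
  simp only [hAF_apply, ArithmeticFunction.isMultiplicative_moebius.map_mul_of_coprime hmn,
    Int.cast_mul, Nat.cast_mul, Nat.totient_mul hmn]
  rw [div_mul_div_comm]
  ring

/-- `Σ_{e ∣ n} h(e) = μ(n)/φ(n)` for squarefree `n` (`= ∏_{p ∣ n}(1 − p/(p−1)) = ∏_{p∣n}(−1/(p−1))`),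
the evaluation of the `d`-sum in (5.28)–(5.29); this is the tree's
`Literature.NumberTheory.Sieve.sum_divisors_moebius_mul_idDivTotient` (`MaynardSieveWeightsM.lean`) after unfolding `h`.
[cite: MaynardAnnals2015, (5.28)–(5.29)] -/
theorem sum_divisors_hAF {n : ℕ} (hn : Squarefree n) :
    ∑ e ∈ n.divisors, hAF e = ((μ n : ℤ) : ℝ) / (n.totient : ℝ) := by
  simp_rw [hAF_apply, mul_div_assoc]
  exact Literature.NumberTheory.Sieve.sum_divisors_moebius_mul_idDivTotient hn

/-- `|Σ_{e ∣ n} h(e)| = 1/φ(n)` for squarefree `n`. [cite: MaynardAnnals2015, (5.29)] -/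
theorem abs_sum_divisors_hAF {n : ℕ} (hn : Squarefree n) :
    |∑ e ∈ n.divisors, hAF e| = 1 / (n.totient : ℝ) := by
  rw [sum_divisors_hAF hn, abs_div, Nat.abs_cast]
  have := ArithmeticFunction.abs_moebius_eq_one_of_squarefree hn
  rw [← Int.cast_abs, show |μ n| = 1 from this]
  simp

/-- The one-variable sum of Lemma 5.3: for `r` squarefree and `u ∣ r`,
`Σ_{u ∣ d ∣ r} μ(d) d/φ(d) = μ(u) (u/φ(u)) Σ_{e ∣ r/u} h(e)`, and in particular it has absolute value
`(u/φ(u)) / φ(r/u)` and equals `μ(u) u/φ(u)` when `r = u`. [cite: MaynardAnnals2015, (5.28)–(5.29)] -/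
theorem sum_divisors_filter_dvd_hAF {u r : ℕ} (hr : Squarefree r) (hu : u ∣ r) :
    ∑ d ∈ r.divisors with u ∣ d, hAF d = hAF u * ∑ e ∈ (r / u).divisors, hAF e :=
  sum_divisors_filter_dvd_of_isMultiplicative isMultiplicative_hAF hr hu


/-! ### Lemma 5.3: `y^{(m)}` in terms of `y` -/

section Lemma53

variable {W B : ℕ} {y : (Fin k → ℕ) → ℝ} {m : Fin k}

/-- `V(n) = Σ_{e ∣ n} h(e)`. [folklore] -/
noncomputable def Vsum (n : ℕ) : ℝ := ∑ e ∈ n.divisors, hAF e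

/-- `V(1) = 1`. [folklore] -/
theorem Vsum_one : Vsum 1 = 1 := by simp [Vsum, hAF_apply]

/-- `|V(n)| = 1/φ(n)` for squarefree `n`. [folklore] -/
theorem abs_Vsum {n : ℕ} (hn : Squarefree n) : |Vsum n| = 1 / (n.totient : ℝ) :=
  abs_sum_divisors_hAF hn

/-- Bridge to `MaynardSieveWeightsM.lean`: on squarefree `n`, `V(n) = μ(n)/φ(n)` is the tree's
`Literature.moebiusDivTotient n` (they differ off squarefrees, e.g. `V(4) = −1`). [folklore] -/
theorem Vsum_eq_moebiusDivTotient {n : ℕ} (hn : Squarefree n) : Vsum n = Literature.NumberTheory.Sieve.moebiusDivTotient n := by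
  rw [Vsum, sum_divisors_hAF hn, Literature.NumberTheory.Sieve.moebiusDivTotient_apply]

/-- Maynard's factor `κ(u) = ∏ᵢ g(uᵢ) uᵢ / φ(uᵢ)²` (`= ∏_{p ∣ ∏uᵢ} (p−2)p/(p−1)² = 1 + O(D₀⁻¹)`,
the product in (5.31)). [cite: MaynardAnnals2015, (5.31)] -/
noncomputable def kappa (u : Fin k → ℕ) : ℝ := ∏ i, gAF (u i) * (u i : ℝ) / (totAF (u i)) ^ 2

/-- The slot-`m` sum `M(u) = Σ_{1 ≤ a ≤ B} y_{u[m ↦ a]} / φ(a)` (the main term of Lemma 5.3).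
[cite: MaynardAnnals2015, Lemma 5.3] -/
noncomputable def Mterm (B : ℕ) (y : (Fin k → ℕ) → ℝ) (m : Fin k) (u : Fin k → ℕ) : ℝ :=
  ∑ a ∈ Finset.Icc 1 B, y (Function.update u m a) / (a.totient : ℝ)

/-- `h(1) = 1`. [folklore] -/
theorem hAF_one : hAF 1 = 1 := by simp [hAF_apply]

/-- `|h(n)| = n/φ(n)` for squarefree `n`. [folklore] -/
theorem abs_hAF {n : ℕ} (hn : Squarefree n) : |hAF n| = (n : ℝ) / n.totient := by
  rw [hAF_apply, abs_div, abs_mul, Nat.abs_cast, Nat.abs_cast]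
  have := ArithmeticFunction.abs_moebius_eq_one_of_squarefree hn
  rw [← Int.cast_abs, show |μ n| = 1 from this]
  simp

/-- `lamM d / ∏φ(dᵢ) = [d_m = 1] (∏ h(dᵢ)) Σ_{d ∣ r} y_r/∏φ(rᵢ)`. [folklore] -/
theorem lamM_div_prod_eq (d : Fin k → ℕ) :
    lamM B y m d / ∏ i, totAF (d i) =
      if d m = 1 then (∏ i, hAF (d i)) *
        ∑ r ∈ (box k B).filter (fun r => ∀ i, d i ∣ r i), y r / ∏ i, ((r i).totient : ℝ) else 0 := by
  rw [lamM_def]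
  split_ifs with hm
  · rw [lam_def, mul_div_right_comm]
    congr 1
    rw [← Finset.prod_div_distrib]
    rfl
  · rw [zero_div]

/-- The `d`-range of Lemma 5.3 (for `u_m = 1` and `r` in the box): the tuples `d` of the box with
`u ∣ d ∣ r` and `d_m = 1` form the product of `{1}` (slot `m`) with the divisor intervals
`{n : uᵢ ∣ n ∣ rᵢ}`. [folklore] -/
theorem filter_box_slot_eq {u r : Fin k → ℕ} (hum : u m = 1) (hr : r ∈ box k B) :
    (box k B).filter (fun d => (∀ i, u i ∣ d i) ∧ d m = 1 ∧ ∀ i, d i ∣ r i) =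
      Fintype.piFinset fun i => if i = m then ({1} : Finset ℕ)
        else (r i).divisors.filter (u i ∣ ·) := by
  rw [mem_box] at hr
  ext d
  simp only [Finset.mem_filter, mem_box, Fintype.mem_piFinset]
  constructor
  · rintro ⟨hbox, hud, hdm, hdr⟩ i
    by_cases hi : i = m
    · subst hi; simp [hdm]
    · rw [if_neg hi, Finset.mem_filter, Nat.mem_divisors]
      exact ⟨⟨hdr i, by have := (hr i).1; omega⟩, hud i⟩
  · intro h
    have hdm : d m = 1 := by have := h m; simpa using this
    have hrest : ∀ i, i ≠ m → d i ∣ r i ∧ u i ∣ d i := fun i hi => by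
      have := h i
      rw [if_neg hi, Finset.mem_filter, Nat.mem_divisors] at this
      exact ⟨this.1.1, this.2⟩
    have hdr : ∀ i, d i ∣ r i := fun i => by
      by_cases hi : i = m
      · subst hi; rw [hdm]; exact one_dvd _
      · exact (hrest i hi).1
    refine ⟨fun i => ⟨?_, (Nat.le_of_dvd (hr i).1 (hdr i)).trans (hr i).2⟩, fun i => ?_, hdm, hdr⟩
    · exact Nat.pos_of_ne_zero fun h0 => by
        have := hdr i; rw [h0, zero_dvd_iff] at this; have := (hr i).1; omega
    · by_cases hi : i = m
      · subst hi; rw [hum]; exact one_dvd _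
      · exact (hrest i hi).2

/-- The local factor of the `d`-sum: `Σ_{uᵢ ∣ n ∣ rᵢ} h(n) = [uᵢ ∣ rᵢ] h(uᵢ) V(rᵢ/uᵢ)` for `rᵢ`
squarefree. [folklore] -/
theorem sum_filter_divisors_hAF_eq {a n : ℕ} (hn : Squarefree n) :
    ∑ e ∈ n.divisors with a ∣ e, hAF e = if a ∣ n then hAF a * Vsum (n / a) else 0 := by
  split_ifs with h
  · rw [sum_divisors_filter_dvd_hAF hn h, Vsum]
  · refine Finset.sum_eq_zero fun e he => ?_
    rw [Finset.mem_filter, Nat.mem_divisors] at he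
    exact absurd (dvd_trans he.2 he.1.1) h

/-- **Lemma 5.3, exact form.** For `u` good with `u_m = 1`:
`y^{(m)}_u = (∏ μ(uᵢ)g(uᵢ)) Σ_{r good} (y_r/∏φ(rᵢ)) ∏_{i ≠ m} [uᵢ ∣ rᵢ] h(uᵢ) V(rᵢ/uᵢ)`
(Maynard (5.27)–(5.29): substitute (5.10) into (5.21), swap the `d`- and `r`-sums and evaluate
the `d`-sum). [cite: MaynardAnnals2015, (5.27)–(5.29)] -/
theorem ym_eq_sum (hy : SupportedOn W B y) {u : Fin k → ℕ} (hum : u m = 1) :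
    ym W B y m u = (∏ i, ((μ (u i) : ℤ) : ℝ) * gAF (u i)) *
      ∑ r ∈ boxG k W B, (y r / ∏ i, ((r i).totient : ℝ)) *
        ∏ i ∈ Finset.univ.erase m, (if u i ∣ r i then hAF (u i) * Vsum (r i / u i) else 0) := by
  rw [ym_def]
  congr 1
  -- Step 1: the `d`-sum over good tuples equals the `d`-sum over the box, with `lamM` unfolded.
  have step1 : ∑ d ∈ (boxG k W B).filter (fun d => ∀ i, u i ∣ d i), lamM B y m d / ∏ i, totAF (d i) =
      ∑ d ∈ (box k B).filter (fun d => (∀ i, u i ∣ d i) ∧ d m = 1),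
        (∏ i, hAF (d i)) * ∑ r ∈ (box k B).filter (fun r => ∀ i, d i ∣ r i),
          y r / ∏ i, ((r i).totient : ℝ) := by
    rw [Finset.sum_filter, Finset.sum_filter]
    -- extend from `boxG` to `box`
    have hext : ∑ d ∈ boxG k W B, (if (∀ i, u i ∣ d i) then lamM B y m d / ∏ i, totAF (d i) else 0) =
        ∑ d ∈ box k B, (if (∀ i, u i ∣ d i) then lamM B y m d / ∏ i, totAF (d i) else 0) := by
      refine Finset.sum_subset (fun d hd => (mem_boxG.1 hd).1) fun d hd hnd => ?_
      split_ifs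
      · rw [lamM_def]
        split_ifs
        · rw [lam_eq_zero_of_not hy hnd, zero_div]
        · rw [zero_div]
      · rfl
    rw [hext]
    refine Finset.sum_congr rfl fun d hd => ?_
    by_cases h1 : ∀ i, u i ∣ d i
    · rw [if_pos h1, lamM_div_prod_eq]
      by_cases h2 : d m = 1
      · rw [if_pos h2, if_pos ⟨h1, h2⟩]
      · rw [if_neg h2, if_neg (fun h => h2 h.2)]
    · rw [if_neg h1, if_neg (fun h => h1 h.1)]
  rw [step1]
  -- Step 2: swap the `d`- and `r`-sums.
  have step2 : ∑ d ∈ (box k B).filter (fun d => (∀ i, u i ∣ d i) ∧ d m = 1),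
      (∏ i, hAF (d i)) * ∑ r ∈ (box k B).filter (fun r => ∀ i, d i ∣ r i),
        y r / ∏ i, ((r i).totient : ℝ) =
      ∑ r ∈ box k B, (y r / ∏ i, ((r i).totient : ℝ)) *
        ∑ d ∈ (box k B).filter (fun d => (∀ i, u i ∣ d i) ∧ d m = 1 ∧ ∀ i, d i ∣ r i),
          ∏ i, hAF (d i) := by
    calc _ = ∑ d ∈ box k B, ∑ r ∈ box k B,
          (if ((∀ i, u i ∣ d i) ∧ d m = 1) ∧ (∀ i, d i ∣ r i) then
            (∏ i, hAF (d i)) * (y r / ∏ i, ((r i).totient : ℝ)) else 0) := by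
          rw [Finset.sum_filter]
          refine Finset.sum_congr rfl fun d _ => ?_
          rw [Finset.mul_sum, Finset.sum_filter]
          split_ifs with h1
          · refine Finset.sum_congr rfl fun r _ => ?_
            by_cases h2 : ∀ i, d i ∣ r i
            · rw [if_pos h2, if_pos ⟨h1, h2⟩]
            · rw [if_neg h2, if_neg (fun h => h2 h.2)]
          · symm
            refine Finset.sum_eq_zero fun r _ => ?_
            rw [if_neg (fun h => h1 h.1)]
      _ = ∑ r ∈ box k B, ∑ d ∈ box k B,
          (if ((∀ i, u i ∣ d i) ∧ d m = 1) ∧ (∀ i, d i ∣ r i) then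
            (∏ i, hAF (d i)) * (y r / ∏ i, ((r i).totient : ℝ)) else 0) := Finset.sum_comm
      _ = _ := by
          refine Finset.sum_congr rfl fun r _ => ?_
          rw [Finset.mul_sum, Finset.sum_filter]
          refine Finset.sum_congr rfl fun d _ => ?_
          by_cases h : (∀ i, u i ∣ d i) ∧ d m = 1 ∧ ∀ i, d i ∣ r i
          · rw [if_pos h, if_pos ⟨⟨h.1, h.2.1⟩, h.2.2⟩]; ring
          · rw [if_neg h, if_neg (fun h' => h ⟨h'.1.1, h'.1.2, h'.2⟩)]
  rw [step2]
  -- Step 3: restrict to good `r` (`y_r = 0` otherwise) and evaluate the `d`-sum.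
  symm
  refine Finset.sum_subset (fun r hr => (mem_boxG.1 hr).1) (fun r hr hnr => ?_) |>.trans ?_
  · have : y r = 0 := by
      by_contra h
      exact hnr (mem_boxG.2 ⟨hr, (hy r h).2⟩)
    rw [this, zero_div, zero_mul]
  refine Finset.sum_congr rfl fun r hr => ?_
  by_cases hyr : y r = 0
  · rw [hyr, zero_div, zero_mul, zero_mul]
  have hrg : r ∈ boxG k W B := mem_boxG.2 ⟨hr, (hy r hyr).2⟩
  congr 1
  rw [filter_box_slot_eq hum hr, ← Finset.prod_univ_sum (fun i => if i = m then ({1} : Finset ℕ)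
    else (r i).divisors.filter (u i ∣ ·)) (fun _ n => hAF n), ← Finset.mul_prod_erase _ _ (Finset.mem_univ m)]
  rw [if_pos rfl, Finset.sum_singleton, hAF_one, one_mul]
  refine Finset.prod_congr rfl fun i hi => ?_
  rw [Finset.mem_erase] at hi
  rw [if_neg hi.1, sum_filter_divisors_hAF_eq ((mem_boxG.1 hrg).2.squarefree_apply i)]


/-- The prefactor has absolute value `∏ g(uᵢ)` on good `u` (and `W` even). [folklore] -/
theorem abs_prefactor_eq (hW : 2 ∣ W) {u : Fin k → ℕ} (hu : u ∈ boxG k W B) :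
    |∏ i, ((μ (u i) : ℤ) : ℝ) * gAF (u i)| = ∏ i, gAF (u i) := by
  rw [Finset.abs_prod]
  refine Finset.prod_congr rfl fun i _ => ?_
  have hG := apply_mem_G1_of_mem_boxG hu i
  rw [abs_mul, abs_of_pos (gAF_pos_of_mem_G1 hW hG)]
  have := ArithmeticFunction.abs_moebius_eq_one_of_squarefree (mem_G1.1 hG).2.1
  rw [← Int.cast_abs, show |μ (u i)| = 1 from this]
  simp

/-- `κ(u) ≥ 0`... in fact `κ(u) > 0` for good `u` and even `W`. [folklore] -/
theorem kappa_pos (hW : 2 ∣ W) {u : Fin k → ℕ} (hu : u ∈ boxG k W B) : 0 < kappa u := by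
  unfold kappa
  refine Finset.prod_pos fun i _ => ?_
  have hG := apply_mem_G1_of_mem_boxG hu i
  have h1 := (mem_G1.1 hG).1.1
  exact div_pos (mul_pos (gAF_pos_of_mem_G1 hW hG) (by exact_mod_cast h1))
    (pow_pos (totAF_pos_of_mem_G1 hG) 2)

/-- **The main term of Lemma 5.3**: the tuples `r` with `rᵢ = uᵢ` for `i ≠ m` contribute exactly
`κ(u) · Σ_a y_{u[m↦a]}/φ(a)` (Maynard (5.31) without its error term).
[cite: MaynardAnnals2015, (5.31)] -/
theorem prefactor_mul_sum_main_eq (hy : SupportedOn W B y) {u : Fin k → ℕ} (hu : u ∈ boxG k W B)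
    (hum : u m = 1) :
    (∏ i, ((μ (u i) : ℤ) : ℝ) * gAF (u i)) *
      ∑ r ∈ (boxG k W B).filter (fun r => ∀ i, i ≠ m → r i = u i),
        (y r / ∏ i, ((r i).totient : ℝ)) *
          ∏ i ∈ Finset.univ.erase m, (if u i ∣ r i then hAF (u i) * Vsum (r i / u i) else 0) =
      kappa u * Mterm B y m u := by
  have huG := apply_mem_G1_of_mem_boxG hu
  -- the value of each main summand
  have hterm : ∀ r ∈ (boxG k W B).filter (fun r => ∀ i, i ≠ m → r i = u i),
      (∏ i, ((μ (u i) : ℤ) : ℝ) * gAF (u i)) *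
        ((y r / ∏ i, ((r i).totient : ℝ)) *
          ∏ i ∈ Finset.univ.erase m, (if u i ∣ r i then hAF (u i) * Vsum (r i / u i) else 0)) =
        kappa u * (y r / ((r m).totient : ℝ)) := by
    intro r hr
    rw [Finset.mem_filter] at hr
    obtain ⟨hrg, hru⟩ := hr
    have hc : ∀ i ∈ Finset.univ.erase m,
        (if u i ∣ r i then hAF (u i) * Vsum (r i / u i) else 0) = hAF (u i) := by
      intro i hi
      rw [Finset.mem_erase] at hi
      have hri : r i = u i := hru i hi.1
      have hu0 : u i ≠ 0 := by have := (mem_G1.1 (huG i)).1.1; omega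
      rw [if_pos (hri ▸ dvd_rfl), hri, Nat.div_self (Nat.pos_of_ne_zero hu0), Vsum_one, mul_one]
    rw [Finset.prod_congr rfl hc]
    -- split off the slot `m` everywhere
    have hφ : (∏ i, ((r i).totient : ℝ)) = ((r m).totient : ℝ) * ∏ i ∈ Finset.univ.erase m, ((u i).totient : ℝ) := by
      rw [← Finset.mul_prod_erase _ _ (Finset.mem_univ m)]
      congr 1
      exact Finset.prod_congr rfl fun i hi => by rw [hru i (Finset.mem_erase.1 hi).1]
    have hP : (∏ i, ((μ (u i) : ℤ) : ℝ) * gAF (u i)) =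
        ∏ i ∈ Finset.univ.erase m, ((μ (u i) : ℤ) : ℝ) * gAF (u i) := by
      rw [← Finset.mul_prod_erase _ _ (Finset.mem_univ m), hum]
      simp [isMultiplicative_gAF.map_one]
    have hκ : kappa u = ∏ i ∈ Finset.univ.erase m, gAF (u i) * (u i : ℝ) / (totAF (u i)) ^ 2 := by
      rw [kappa, ← Finset.mul_prod_erase _ _ (Finset.mem_univ m), hum]
      simp [isMultiplicative_gAF.map_one, totAF_apply]
    have hφ0 : ∀ i, ((u i).totient : ℝ) ≠ 0 := fun i => (totAF_pos_of_mem_G1 (huG i)).ne'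
    have hφprod : (∏ i ∈ Finset.univ.erase m, ((u i).totient : ℝ)) ≠ 0 :=
      Finset.prod_ne_zero_iff.2 fun i _ => hφ0 i
    have hrm0 : ((r m).totient : ℝ) ≠ 0 := (totAF_pos_of_mem_G1 (apply_mem_G1_of_mem_boxG hrg m)).ne'
    rw [hφ, hP, hκ]
    -- `∏ (μ g)(uᵢ) · ∏ h(uᵢ) / ∏ φ(uᵢ) = ∏ g(uᵢ)uᵢ/φ(uᵢ)²`
    have hloc : ∀ i ∈ Finset.univ.erase m,
        ((μ (u i) : ℤ) : ℝ) * gAF (u i) * hAF (u i) / ((u i).totient : ℝ) =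
          gAF (u i) * (u i : ℝ) / (totAF (u i)) ^ 2 := by
      intro i _
      have hμ2 : ((μ (u i) : ℤ) : ℝ) * ((μ (u i) : ℤ) : ℝ) = 1 := by
        have := ArithmeticFunction.moebius_sq_eq_one_of_squarefree (mem_G1.1 (huG i)).2.1
        rw [← sq]; exact_mod_cast this
      rw [hAF_apply, totAF_apply]
      have : ((μ (u i) : ℤ) : ℝ) * gAF (u i) * (((μ (u i) : ℤ) : ℝ) * (u i : ℝ) / ((u i).totient : ℝ)) /
          ((u i).totient : ℝ) =
          (((μ (u i) : ℤ) : ℝ) * ((μ (u i) : ℤ) : ℝ)) * (gAF (u i) * (u i : ℝ) / ((u i).totient : ℝ) ^ 2) := by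
        ring
      rw [this, hμ2, one_mul]
    calc (∏ i ∈ Finset.univ.erase m, ((μ (u i) : ℤ) : ℝ) * gAF (u i)) *
          (y r / (((r m).totient : ℝ) * ∏ i ∈ Finset.univ.erase m, ((u i).totient : ℝ)) *
            ∏ i ∈ Finset.univ.erase m, hAF (u i))
        = (∏ i ∈ Finset.univ.erase m, ((μ (u i) : ℤ) : ℝ) * gAF (u i) * hAF (u i) / ((u i).totient : ℝ)) *
            (y r / ((r m).totient : ℝ)) := by
          rw [Finset.prod_div_distrib, Finset.prod_mul_distrib, Finset.prod_mul_distrib,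
            Finset.prod_mul_distrib]
          field_simp
      _ = _ := by rw [Finset.prod_congr rfl hloc]
  rw [Finset.mul_sum, Finset.sum_congr rfl hterm, ← Finset.mul_sum]
  congr 1
  -- the main `r` range is the image of `a ↦ u[m ↦ a]`
  rw [Mterm]
  have hinj : Set.InjOn (Function.update u m) (Finset.Icc 1 B : Set ℕ) := by
    intro a _ b _ h
    have := congrFun h m
    simpa using this
  have hrhs : ∑ a ∈ Finset.Icc 1 B, y (Function.update u m a) / ((a.totient : ℝ)) =
      ∑ a ∈ Finset.Icc 1 B, (fun r => y r / ((r m).totient : ℝ)) (Function.update u m a) := by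
    refine Finset.sum_congr rfl fun a _ => ?_
    simp
  rw [hrhs, ← Finset.sum_image (f := fun r => y r / ((r m).totient : ℝ)) hinj]
  refine Finset.sum_subset (fun r hr => ?_) fun r hr hnr => ?_
  · -- `Main ⊆ image`
    rw [Finset.mem_filter] at hr
    rw [Finset.mem_image]
    refine ⟨r m, ?_, ?_⟩
    · have := (mem_box.1 (mem_boxG.1 hr.1).1) m
      exact Finset.mem_Icc.2 this
    · funext i
      by_cases hi : i = m
      · subst hi; simp
      · rw [Function.update_of_ne hi, hr.2 i hi]
  · -- on `image \ Main`, `y = 0`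
    rw [Finset.mem_image] at hr
    obtain ⟨a, _, rfl⟩ := hr
    have : y (Function.update u m a) = 0 := by
      by_contra h
      apply hnr
      rw [Finset.mem_filter]
      refine ⟨mem_boxG.2 ⟨(hy _ h).1, (hy _ h).2⟩, fun i hi => ?_⟩
      rw [Function.update_of_ne hi]
    simp only [this, zero_div]


/-- The weight of the error terms of Lemma 5.3: `w(t) = (1/φ(t_m)) ∏_{i ≠ m} 1/φ(tᵢ)²`. [folklore] -/
noncomputable def wfun (m : Fin k) (t : Fin k → ℕ) : ℝ :=
  (1 / ((t m).totient : ℝ)) * ∏ i ∈ Finset.univ.erase m, 1 / ((t i).totient : ℝ) ^ 2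

/-- `w ≥ 0`. [folklore] -/
theorem wfun_nonneg (m : Fin k) (t : Fin k → ℕ) : 0 ≤ wfun m t := by
  unfold wfun
  exact mul_nonneg (by positivity) (Finset.prod_nonneg fun i _ => by positivity)

/-- **The error terms of Lemma 5.3, termwise** (Maynard (5.30)): for good `u` with `u_m = 1` and a
good `r` which is not of the form `u[m ↦ a]`,
`|∏μ(uᵢ)g(uᵢ)| · |y_r/∏φ(rᵢ)| · ∏_{i≠m} |[uᵢ∣rᵢ] h(uᵢ)V(rᵢ/uᵢ)| ≤ y_max κ(u) w(r/u)` (and `= 0`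
unless `u ∣ r`). [cite: MaynardAnnals2015, (5.30)] -/
theorem abs_rest_term_le (hW : 2 ∣ W) {u : Fin k → ℕ} (hu : u ∈ boxG k W B) (hum : u m = 1)
    {ymax : ℝ} (hymax : ∀ r, |y r| ≤ ymax) {r : Fin k → ℕ} (hr : r ∈ boxG k W B) :
    |(∏ i, ((μ (u i) : ℤ) : ℝ) * gAF (u i)) *
        ((y r / ∏ i, ((r i).totient : ℝ)) *
          ∏ i ∈ Finset.univ.erase m, (if u i ∣ r i then hAF (u i) * Vsum (r i / u i) else 0))| ≤
      ymax * kappa u * (if ∀ i, u i ∣ r i then wfun m (fun i => r i / u i) else 0) := by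
  have huG := apply_mem_G1_of_mem_boxG hu
  have hrG := apply_mem_G1_of_mem_boxG hr
  have hy0 : 0 ≤ ymax := le_trans (abs_nonneg _) (hymax r)
  have hκ := kappa_pos hW hu
  by_cases hdiv : ∀ i, u i ∣ r i
  swap
  · -- some factor of the product vanishes
    rw [if_neg hdiv]
    obtain ⟨i, hi⟩ := not_forall.1 hdiv
    have him : i ≠ m := fun h => hi (by rw [h, hum]; exact one_dvd _)
    rw [Finset.prod_eq_zero (Finset.mem_erase.2 ⟨him, Finset.mem_univ i⟩) (if_neg hi)]
    simp
  rw [if_pos hdiv]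
  -- write `rᵢ = uᵢ tᵢ`
  set t : Fin k → ℕ := fun i => r i / u i with ht
  have hrt : ∀ i, r i = u i * t i := fun i => (Nat.mul_div_cancel' (hdiv i)).symm
  have hcop : ∀ i, (u i).Coprime (t i) := fun i =>
    Nat.coprime_of_squarefree_mul (hrt i ▸ (mem_G1.1 (hrG i)).2.1)
  have htsq : ∀ i, Squarefree (t i) := fun i =>
    (mem_G1.1 (hrG i)).2.1.squarefree_of_dvd (Nat.div_dvd_of_dvd (hdiv i))
  have hφr : ∀ i, ((r i).totient : ℝ) = ((u i).totient : ℝ) * ((t i).totient : ℝ) := fun i => by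
    rw [hrt i, Nat.totient_mul (hcop i), Nat.cast_mul]
  have hφu : ∀ i, 0 < ((u i).totient : ℝ) := fun i => totAF_pos_of_mem_G1 (huG i)
  have hφt : ∀ i, 0 < ((t i).totient : ℝ) := fun i => by
    have : 0 < t i := Nat.pos_of_ne_zero (htsq i).ne_zero
    exact_mod_cast Nat.totient_pos.2 this
  -- termwise bounds
  have hc : ∀ i ∈ Finset.univ.erase m,
      |(if u i ∣ r i then hAF (u i) * Vsum (r i / u i) else 0)| ≤
        ((u i : ℝ) / (u i).totient) * (1 / ((t i).totient : ℝ)) := by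
    intro i _
    rw [if_pos (hdiv i), abs_mul, abs_hAF (mem_G1.1 (huG i)).2.1, abs_Vsum (htsq i)]
  have hP := abs_prefactor_eq hW hu
  rw [abs_mul, hP, abs_mul, abs_div, Finset.abs_prod]
  have hφabs : ∏ i, |((r i).totient : ℝ)| = ∏ i, ((u i).totient : ℝ) * ((t i).totient : ℝ) :=
    Finset.prod_congr rfl fun i _ => by rw [abs_of_pos (by rw [hφr i]; exact mul_pos (hφu i) (hφt i)), hφr i]
  rw [hφabs]
  calc (∏ i, gAF (u i)) * (|y r| / (∏ i, ((u i).totient : ℝ) * ((t i).totient : ℝ)) *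
        |∏ i ∈ Finset.univ.erase m, (if u i ∣ r i then hAF (u i) * Vsum (r i / u i) else 0)|)
      ≤ (∏ i, gAF (u i)) * (ymax / (∏ i, ((u i).totient : ℝ) * ((t i).totient : ℝ)) *
        ∏ i ∈ Finset.univ.erase m, ((u i : ℝ) / (u i).totient) * (1 / ((t i).totient : ℝ))) := by
        refine mul_le_mul_of_nonneg_left ?_ (Finset.prod_nonneg fun i _ => (gAF_pos_of_mem_G1 hW (huG i)).le)
        refine mul_le_mul ?_ ?_ (abs_nonneg _) (div_nonneg hy0 (Finset.prod_nonneg fun i _ => (mul_pos (hφu i) (hφt i)).le))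
        · exact div_le_div_of_nonneg_right (hymax r) (Finset.prod_nonneg fun i _ => (mul_pos (hφu i) (hφt i)).le)
        · rw [Finset.abs_prod]
          exact Finset.prod_le_prod (fun i _ => abs_nonneg _) hc
    _ = ymax * kappa u * wfun m t := by
        -- split off the slot `m` in every product over `univ`
        rw [kappa, wfun, ← Finset.mul_prod_erase _ _ (Finset.mem_univ m),
          ← Finset.mul_prod_erase Finset.univ (fun i => ((u i).totient : ℝ) * ((t i).totient : ℝ)) (Finset.mem_univ m),
          ← Finset.mul_prod_erase Finset.univ (fun i => gAF (u i) * (u i : ℝ) / (totAF (u i)) ^ 2) (Finset.mem_univ m)]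
        simp only [hum, isMultiplicative_gAF.map_one, Nat.totient_one, Nat.cast_one, one_mul, totAF_apply,
          one_pow, div_one, mul_one]
        have hprod_ne : ∀ i, ((u i).totient : ℝ) * ((t i).totient : ℝ) ≠ 0 := fun i =>
          (mul_pos (hφu i) (hφt i)).ne'
        rw [show (t m : ℕ) = r m from by simp [ht, hum]]
        -- combine the products over `univ.erase m`
        have key : ∀ i ∈ Finset.univ.erase m,
            gAF (u i) * (((u i : ℝ) / (u i).totient) * (1 / ((t i).totient : ℝ))) /
              (((u i).totient : ℝ) * ((t i).totient : ℝ)) =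
            (gAF (u i) * (u i : ℝ) / ((u i).totient : ℝ) ^ 2) * (1 / ((t i).totient : ℝ) ^ 2) := by
          intro i _
          have h1 := (hφu i).ne'
          have h2 := (hφt i).ne'
          field_simp
        have e1 : (∏ x ∈ Finset.univ.erase m, gAF (u x)) *
            (ymax / (((r m).totient : ℝ) * ∏ x ∈ Finset.univ.erase m, ((u x).totient : ℝ) * ((t x).totient : ℝ)) *
              ∏ i ∈ Finset.univ.erase m, (u i : ℝ) / (u i).totient * (1 / ((t i).totient : ℝ))) =
            ymax * (1 / ((r m).totient : ℝ)) *
              ((∏ x ∈ Finset.univ.erase m, gAF (u x)) *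
                (∏ i ∈ Finset.univ.erase m, (u i : ℝ) / (u i).totient * (1 / ((t i).totient : ℝ))) /
                ∏ x ∈ Finset.univ.erase m, ((u x).totient : ℝ) * ((t x).totient : ℝ)) := by
          ring
        rw [e1, ← Finset.prod_mul_distrib, ← Finset.prod_div_distrib, Finset.prod_congr rfl key,
          Finset.prod_mul_distrib]
        ring


/-- Union bound: a nonnegative sum over `{t : ∃ j ∈ J, P j t}` is at most the sum over `j ∈ J` of the
sums over `{t : P j t}` (a `Finset` version; a `Fintype`-only twin lives in
`Literature/Computability/Cryptography/ShorOrderFindingQuantum.lean`). [folklore] -/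
theorem sum_filter_exists_le {ι α : Type*} (J : Finset ι) (T : Finset α)
    (P : ι → α → Prop) [∀ j, DecidablePred (P j)] [DecidablePred (fun t => ∃ j ∈ J, P j t)]
    (w : α → ℝ) (hw : ∀ t ∈ T, 0 ≤ w t) :
    ∑ t ∈ T.filter (fun t => ∃ j ∈ J, P j t), w t ≤ ∑ j ∈ J, ∑ t ∈ T.filter (P j), w t := by
  rw [Finset.sum_filter]
  simp_rw [Finset.sum_filter]
  rw [Finset.sum_comm]
  refine Finset.sum_le_sum fun t ht => ?_
  split_ifs with h
  · obtain ⟨j, hj, hP⟩ := h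
    calc w t = ∑ i ∈ ({j} : Finset ι), (if P i t then w t else 0) := by simp [hP]
      _ ≤ ∑ i ∈ J, (if P i t then w t else 0) :=
          Finset.sum_le_sum_of_subset_of_nonneg (by simpa using hj) fun i _ _ => by
            split_ifs
            · exact hw t ht
            · rfl
  · exact Finset.sum_nonneg fun i _ => by
      split_ifs
      · exact hw t ht
      · rfl

/-- `w` as a product over all coordinates. [folklore] -/
theorem wfun_eq_prod (m : Fin k) (t : Fin k → ℕ) :
    wfun m t = ∏ i, (if i = m then 1 / ((t i).totient : ℝ) else 1 / ((t i).totient : ℝ) ^ 2) := by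
  rw [wfun, ← Finset.mul_prod_erase _ _ (Finset.mem_univ m), if_pos rfl]
  congr 1
  exact Finset.prod_congr rfl fun i hi => by rw [if_neg (Finset.mem_erase.1 hi).1]

/-- For `j ≠ m`: `Σ_{t ∈ G1^k, t_j ≠ 1} w(t) ≤ L (Z − 1) Z^k` with `L = Σ_{G1} 1/φ`, `Z = Σ_{G1} 1/φ²`
(the `j`-th factor is `Z − 1`, the `m`-th is `L`, the others are `Z ≥ 1`). [cite: MaynardAnnals2015, (5.30)] -/
theorem sum_wfun_filter_le (hB : 1 ≤ B) (m : Fin k) {j : Fin k} (hjm : j ≠ m) :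
    ∑ t ∈ (Fintype.piFinset fun _ : Fin k => G1 W B).filter (fun t => t j ≠ 1), wfun m t ≤
      (∑ n ∈ G1 W B, 1 / (n.totient : ℝ)) *
        ((∑ n ∈ G1 W B, 1 / (n.totient : ℝ) ^ 2 - 1) * (∑ n ∈ G1 W B, 1 / (n.totient : ℝ) ^ 2) ^ k) := by
  set L := ∑ n ∈ G1 W B, 1 / (n.totient : ℝ) with hL
  set Z := ∑ n ∈ G1 W B, 1 / (n.totient : ℝ) ^ 2 with hZ
  have h1G : 1 ∈ G1 W B := mem_G1.2 ⟨⟨le_rfl, hB⟩, squarefree_one, Nat.coprime_one_left W⟩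
  have hL0 : 0 ≤ L := Finset.sum_nonneg fun _ _ => by positivity
  have hZ1 : 1 ≤ Z := by
    rw [hZ, ← Finset.add_sum_erase _ _ h1G]
    simp only [Nat.totient_one, Nat.cast_one, one_pow, ne_eq, one_ne_zero, not_false_eq_true,
      div_self, le_add_iff_nonneg_right]
    exact Finset.sum_nonneg fun _ _ => by positivity
  have hZ1' : Z - 1 = ∑ n ∈ (G1 W B).erase 1, 1 / (n.totient : ℝ) ^ 2 := by
    rw [hZ, ← Finset.add_sum_erase _ _ h1G]; simp
  -- the filtered box is a product box
  have hset : (Fintype.piFinset fun _ : Fin k => G1 W B).filter (fun t => t j ≠ 1) =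
      Fintype.piFinset fun i => if i = j then (G1 W B).erase 1 else G1 W B := by
    ext t
    simp only [Finset.mem_filter, Fintype.mem_piFinset]
    constructor
    · rintro ⟨h, hj⟩ i
      by_cases hi : i = j
      · subst hi; rw [if_pos rfl, Finset.mem_erase]; exact ⟨hj, h i⟩
      · rw [if_neg hi]; exact h i
    · intro h
      refine ⟨fun i => ?_, ?_⟩
      · have := h i
        by_cases hi : i = j
        · subst hi; rw [if_pos rfl, Finset.mem_erase] at this; exact this.2
        · rwa [if_neg hi] at this
      · have := h j; rw [if_pos rfl, Finset.mem_erase] at this; exact this.1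
  rw [hset]
  simp_rw [wfun_eq_prod]
  rw [← Finset.prod_univ_sum (fun i => if i = j then (G1 W B).erase 1 else G1 W B)
    (fun i n => if i = m then 1 / (n.totient : ℝ) else 1 / (n.totient : ℝ) ^ 2)]
  -- evaluate / bound the factors
  have hfac : ∀ i, ∑ n ∈ (if i = j then (G1 W B).erase 1 else G1 W B),
      (if i = m then 1 / (n.totient : ℝ) else 1 / (n.totient : ℝ) ^ 2) =
      if i = m then L else if i = j then Z - 1 else Z := by
    intro i
    by_cases him : i = m
    · subst him
      simp only [↓reduceIte, hjm.symm, hL]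
    · by_cases hij : i = j
      · subst hij
        simp only [↓reduceIte, him, hZ1']
      · simp only [him, hij, ↓reduceIte, hZ]
  simp_rw [hfac]
  rw [← Finset.mul_prod_erase _ _ (Finset.mem_univ m), if_pos rfl,
    ← Finset.mul_prod_erase _ _ (Finset.mem_erase.2 ⟨hjm, Finset.mem_univ j⟩), if_neg hjm, if_pos rfl]
  refine mul_le_mul_of_nonneg_left (mul_le_mul_of_nonneg_left ?_ (by linarith)) hL0
  calc ∏ x ∈ (Finset.univ.erase m).erase j, (if x = m then L else if x = j then Z - 1 else Z)
      = ∏ x ∈ (Finset.univ.erase m).erase j, Z := by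
        refine Finset.prod_congr rfl fun x hx => ?_
        rw [Finset.mem_erase, Finset.mem_erase] at hx
        rw [if_neg hx.2.1, if_neg hx.1]
    _ = Z ^ ((Finset.univ.erase m).erase j).card := Finset.prod_const Z
    _ ≤ Z ^ k := pow_le_pow_right₀ hZ1 (by
        calc ((Finset.univ.erase m).erase j).card ≤ (Finset.univ : Finset (Fin k)).card :=
              Finset.card_le_card ((Finset.erase_subset _ _).trans (Finset.erase_subset _ _))
          _ = k := by rw [Finset.card_univ, Fintype.card_fin])


/-- Reindexing the error terms by `t = r/u`: the total weight of the "rest" is at most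
`Σ_{j ≠ m} Σ_{t ∈ G1^k, t_j ≠ 1} w(t)`. [cite: MaynardAnnals2015, (5.30)] -/
theorem sum_rest_wfun_le {u : Fin k → ℕ} (hu : u ∈ boxG k W B) :
    ∑ r ∈ (boxG k W B).filter (fun r => ¬∀ i, i ≠ m → r i = u i),
        (if ∀ i, u i ∣ r i then wfun m (fun i => r i / u i) else 0) ≤
      ∑ j ∈ Finset.univ.erase m,
        ∑ t ∈ (Fintype.piFinset fun _ : Fin k => G1 W B).filter (fun t => t j ≠ 1), wfun m t := by
  have huG := apply_mem_G1_of_mem_boxG hu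
  rw [← Finset.sum_filter]
  have hinjOn : Set.InjOn (fun r : Fin k → ℕ => fun i => r i / u i)
      ((((boxG k W B).filter (fun r => ¬∀ i, i ≠ m → r i = u i)).filter
        (fun r => ∀ i, u i ∣ r i)) : Set (Fin k → ℕ)) := by
    intro r hr r' hr' h
    rw [Finset.mem_coe, Finset.mem_filter] at hr hr'
    funext i
    have h1 := congrFun h i
    simp only at h1
    have hu0 : 0 < u i := (mem_G1.1 (huG i)).1.1
    rw [Nat.div_eq_iff_eq_mul_left hu0 (hr.2 i)] at h1
    rw [h1, Nat.div_mul_cancel (hr'.2 i)]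
  refine le_of_eq_of_le (Finset.sum_image (f := wfun m) hinjOn).symm ?_
  refine le_trans ?_ (sum_filter_exists_le (Finset.univ.erase m)
    (Fintype.piFinset fun _ : Fin k => G1 W B) (fun j t => t j ≠ 1) (wfun m)
    fun t _ => wfun_nonneg m t)
  refine Finset.sum_le_sum_of_subset_of_nonneg (fun t ht => ?_) fun t _ _ => wfun_nonneg m t
  rw [Finset.mem_image] at ht
  obtain ⟨r, hr, rfl⟩ := ht
  rw [Finset.mem_filter, Finset.mem_filter] at hr
  obtain ⟨⟨hrg, hne⟩, hdiv⟩ := hr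
  rw [Finset.mem_filter, Fintype.mem_piFinset]
  refine ⟨fun i => mem_G1_of_dvd (apply_mem_G1_of_mem_boxG hrg i) (Nat.div_dvd_of_dvd (hdiv i)), ?_⟩
  obtain ⟨j, hj⟩ := not_forall.1 hne
  obtain ⟨hjm, hrj⟩ := Classical.not_imp.1 hj
  refine ⟨j, Finset.mem_erase.2 ⟨hjm, Finset.mem_univ j⟩, fun h1 => hrj ?_⟩
  have h1' : r j / u j = 1 := h1
  have := Nat.div_mul_cancel (hdiv j)
  rw [h1', one_mul] at this
  exact this.symm

/-- **Lemma 5.3** (Maynard 2015): for `W` even, `y` supported on good tuples of the box `[1,B]^k`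
with `|y| ≤ y_max`, and a good `u` with `u_m = 1`,
`|y^{(m)}_u − κ(u) Σ_a y_{u[m↦a]}/φ(a)| ≤ y_max κ(u) · k L (Z − 1) Z^k`,
`L = Σ_{n ≤ B good} 1/φ(n)`, `Z = Σ_{n ≤ B good} 1/φ(n)²` (Maynard: `≪ y_max φ(W) log R/(W D₀)`,
since `L ≪ φ(W) log R / W` and `Z − 1 ≪ 1/D₀`). [cite: MaynardAnnals2015, Lemma 5.3] -/
theorem abs_ym_sub_main_le (hW : 2 ∣ W) (hy : SupportedOn W B y) {ymax : ℝ}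
    (hymax : ∀ r, |y r| ≤ ymax) {u : Fin k → ℕ} (hu : u ∈ boxG k W B) (hum : u m = 1) :
    |ym W B y m u - kappa u * Mterm B y m u| ≤
      ymax * kappa u * ((k : ℝ) * ((∑ n ∈ G1 W B, 1 / (n.totient : ℝ)) *
        ((∑ n ∈ G1 W B, 1 / (n.totient : ℝ) ^ 2 - 1) *
          (∑ n ∈ G1 W B, 1 / (n.totient : ℝ) ^ 2) ^ k))) := by
  have hB : 1 ≤ B := by
    have := (mem_box.1 (mem_boxG.1 hu).1 m)
    exact this.1.trans this.2
  set L := ∑ n ∈ G1 W B, 1 / (n.totient : ℝ) with hL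
  set Z := ∑ n ∈ G1 W B, 1 / (n.totient : ℝ) ^ 2 with hZ
  have hy0 : 0 ≤ ymax := le_trans (abs_nonneg _) (hymax u)
  have hκ := kappa_pos hW hu
  have h1G : 1 ∈ G1 W B := mem_G1.2 ⟨⟨le_rfl, hB⟩, squarefree_one, Nat.coprime_one_left W⟩
  have hL0 : 0 ≤ L := Finset.sum_nonneg fun _ _ => by positivity
  have hZ1 : 1 ≤ Z := by
    rw [hZ, ← Finset.add_sum_erase _ _ h1G]
    simp only [Nat.totient_one, Nat.cast_one, one_pow, ne_eq, one_ne_zero, not_false_eq_true,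
      div_self, le_add_iff_nonneg_right]
    exact Finset.sum_nonneg fun _ _ => by positivity
  have hc0 : 0 ≤ L * ((Z - 1) * Z ^ k) := mul_nonneg hL0 (mul_nonneg (by linarith) (by positivity))
  rw [ym_eq_sum hy hum]
  set P := ∏ i, ((μ (u i) : ℤ) : ℝ) * gAF (u i) with hP
  set T : (Fin k → ℕ) → ℝ := fun r => (y r / ∏ i, ((r i).totient : ℝ)) *
    ∏ i ∈ Finset.univ.erase m, (if u i ∣ r i then hAF (u i) * Vsum (r i / u i) else 0) with hT
  rw [← Finset.sum_filter_add_sum_filter_not (boxG k W B) (fun r => ∀ i, i ≠ m → r i = u i) T,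
    mul_add, prefactor_mul_sum_main_eq hy hu hum, add_sub_cancel_left, Finset.mul_sum]
  calc |∑ r ∈ (boxG k W B).filter (fun r => ¬∀ i, i ≠ m → r i = u i), P * T r|
      ≤ ∑ r ∈ (boxG k W B).filter (fun r => ¬∀ i, i ≠ m → r i = u i), |P * T r| :=
        Finset.abs_sum_le_sum_abs _ _
    _ ≤ ∑ r ∈ (boxG k W B).filter (fun r => ¬∀ i, i ≠ m → r i = u i),
          ymax * kappa u * (if ∀ i, u i ∣ r i then wfun m (fun i => r i / u i) else 0) := by
        refine Finset.sum_le_sum fun r hr => ?_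
        exact abs_rest_term_le hW hu hum hymax (Finset.mem_filter.1 hr).1
    _ = ymax * kappa u * ∑ r ∈ (boxG k W B).filter (fun r => ¬∀ i, i ≠ m → r i = u i),
          (if ∀ i, u i ∣ r i then wfun m (fun i => r i / u i) else 0) := by rw [Finset.mul_sum]
    _ ≤ ymax * kappa u * ∑ j ∈ Finset.univ.erase m,
          ∑ t ∈ (Fintype.piFinset fun _ : Fin k => G1 W B).filter (fun t => t j ≠ 1), wfun m t :=
        mul_le_mul_of_nonneg_left (sum_rest_wfun_le hu) (by positivity)
    _ ≤ ymax * kappa u * ∑ _j ∈ Finset.univ.erase m, L * ((Z - 1) * Z ^ k) := by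
        refine mul_le_mul_of_nonneg_left (Finset.sum_le_sum fun j hj => ?_) (by positivity)
        exact sum_wfun_filter_le hB m (Finset.mem_erase.1 hj).1
    _ ≤ ymax * kappa u * ((k : ℝ) * (L * ((Z - 1) * Z ^ k))) := by
        refine mul_le_mul_of_nonneg_left ?_ (by positivity)
        rw [Finset.sum_const, nsmul_eq_mul]
        refine mul_le_mul_of_nonneg_right ?_ hc0
        have : ((Finset.univ.erase m).card : ℝ) ≤ k := by
          have h := Finset.card_erase_le (s := (Finset.univ : Finset (Fin k))) (a := m)
          rw [Finset.card_univ, Fintype.card_fin] at h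
          exact_mod_cast h
        exact this

/-- `y^{(m)}_u = 0` unless `u_m = 1` (Maynard: "We note `y^{(m)}_{r} = 0` unless `r_m = 1`").
[cite: MaynardAnnals2015, after (5.24)] -/
theorem ym_eq_zero_of_ne {u : Fin k → ℕ} (hum : u m ≠ 1) : ym W B y m u = 0 := by
  rw [ym_def]
  refine mul_eq_zero_of_right _ (Finset.sum_eq_zero fun d hd => ?_)
  rw [Finset.mem_filter] at hd
  rw [lamM_def, if_neg, zero_div]
  intro hdm
  exact hum (Nat.dvd_one.1 (hdm ▸ hd.2 m))

/-- `|Σ_a y_{u[m↦a]}/φ(a)| ≤ y_max L`. [folklore] -/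
theorem abs_Mterm_le (hy : SupportedOn W B y) {ymax : ℝ} (hymax : ∀ r, |y r| ≤ ymax)
    (u : Fin k → ℕ) :
    |Mterm B y m u| ≤ ymax * ∑ n ∈ G1 W B, 1 / (n.totient : ℝ) := by
  have hy0 : 0 ≤ ymax := le_trans (abs_nonneg _) (hymax u)
  rw [Mterm]
  calc |∑ a ∈ Finset.Icc 1 B, y (Function.update u m a) / (a.totient : ℝ)|
      ≤ ∑ a ∈ Finset.Icc 1 B, |y (Function.update u m a)| / (a.totient : ℝ) := by
        refine (Finset.abs_sum_le_sum_abs _ _).trans (Finset.sum_le_sum fun a _ => ?_)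
        rw [abs_div, Nat.abs_cast]
    _ = ∑ a ∈ G1 W B, |y (Function.update u m a)| / (a.totient : ℝ) := by
        symm
        refine Finset.sum_subset (fun a ha => Finset.mem_Icc.2 (mem_G1.1 ha).1) fun a _ hna => ?_
        have : y (Function.update u m a) = 0 := by
          by_contra h
          have hg := (hy _ h).2
          have := apply_mem_G1_of_mem_boxG (mem_boxG.2 ⟨(hy _ h).1, hg⟩) m
          simp at this
          exact hna this
        rw [this, abs_zero, zero_div]
    _ ≤ ∑ a ∈ G1 W B, ymax * (1 / (a.totient : ℝ)) := by
        refine Finset.sum_le_sum fun a _ => ?_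
        rw [mul_one_div]
        exact div_le_div_of_nonneg_right (hymax _) (by positivity)
    _ = ymax * ∑ n ∈ G1 W B, 1 / (n.totient : ℝ) := by rw [Finset.mul_sum]


end Lemma53

/-! ### The size of `κ(u)`: `1 − k/(D₀ − 1) ≤ κ(u) ≤ 1` -/

section Kappa

variable {W B : ℕ}

/-- For a squarefree `n`: `g(n) n / φ(n)² = ∏_{p ∣ n} (1 − 1/(p−1)²)` (Maynard: "`g(p)p/φ(p)² =
1 + O(p⁻²)`"). [cite: MaynardAnnals2015, end of proof of Lemma 5.3] -/
theorem gAF_mul_div_sq_eq {n : ℕ} (hn : Squarefree n) :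
    gAF n * (n : ℝ) / (totAF n) ^ 2 = ∏ p ∈ n.primeFactors, (1 - 1 / ((p : ℝ) - 1) ^ 2) := by
  have hφ : totAF n = ∏ p ∈ n.primeFactors, ((p : ℝ) - 1) := by
    rw [← isMultiplicative_totAF.prod_primeFactors hn]
    refine Finset.prod_congr rfl fun p hp => ?_
    have hpp := Nat.prime_of_mem_primeFactors hp
    rw [totAF_apply, Nat.totient_prime hpp, Nat.cast_sub hpp.one_lt.le, Nat.cast_one]
  have hnprod : (n : ℝ) = ∏ p ∈ n.primeFactors, (p : ℝ) := by
    rw [← Nat.cast_prod, Nat.prod_primeFactors_of_squarefree hn]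
  rw [gAF_apply hn.ne_zero, hφ, hnprod, ← Finset.prod_mul_distrib, ← Finset.prod_pow,
    ← Finset.prod_div_distrib]
  refine Finset.prod_congr rfl fun p hp => ?_
  have hpp := Nat.prime_of_mem_primeFactors hp
  have h2 : (2 : ℝ) ≤ p := by exact_mod_cast hpp.two_le
  have : (p : ℝ) - 1 ≠ 0 := by linarith
  field_simp
  ring

/-- `κ(u) ≤ 1` for good `u`. [cite: MaynardAnnals2015, Lemma 5.3] -/
theorem kappa_le_one {u : Fin k → ℕ} (hu : u ∈ boxG k W B) : kappa u ≤ 1 := by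
  have huG := apply_mem_G1_of_mem_boxG hu
  unfold kappa
  refine Finset.prod_le_one (fun i _ => ?_) fun i _ => ?_
  · rw [gAF_mul_div_sq_eq (mem_G1.1 (huG i)).2.1]
    refine Finset.prod_nonneg fun p hp => ?_
    have hpp := Nat.prime_of_mem_primeFactors hp
    have h2 : (2 : ℝ) ≤ p := by exact_mod_cast hpp.two_le
    have : 1 / ((p : ℝ) - 1) ^ 2 ≤ 1 := by
      rw [div_le_one (by nlinarith)]; nlinarith
    linarith
  · rw [gAF_mul_div_sq_eq (mem_G1.1 (huG i)).2.1]
    refine Finset.prod_le_one (fun p hp => ?_) fun p hp => ?_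
    · have hpp := Nat.prime_of_mem_primeFactors hp
      have h2 : (2 : ℝ) ≤ p := by exact_mod_cast hpp.two_le
      have : 1 / ((p : ℝ) - 1) ^ 2 ≤ 1 := by
        rw [div_le_one (by nlinarith)]; nlinarith
      linarith
    · have : 0 ≤ 1 / ((p : ℝ) - 1) ^ 2 := by positivity
      linarith

/-- `Σ_{D₀ < n ≤ M} 1/(n−1)² ≤ 1/(D₀−1) − 1/(M−1)` for `2 ≤ D₀ ≤ M`: Mathlib's
`sum_Ioc_inv_sq_le_sub` (`Σ_{i ∈ Ioc k n} 1/i² ≤ 1/k − 1/n`) after the shift `n = i + 1`. [folklore] -/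
theorem sum_Ioc_inv_sq_le {D₀ M : ℕ} (hD : 2 ≤ D₀) (hM : D₀ ≤ M) :
    ∑ n ∈ Finset.Ioc D₀ M, 1 / ((n : ℝ) - 1) ^ 2 ≤ 1 / ((D₀ : ℝ) - 1) - 1 / ((M : ℝ) - 1) := by
  have h := sum_Ioc_inv_sq_le_sub (α := ℝ) (k := D₀ - 1) (n := M - 1) (by omega) (by omega)
  have hshift : ∑ n ∈ Finset.Ioc D₀ M, 1 / ((n : ℝ) - 1) ^ 2 =
      ∑ i ∈ Finset.Ioc (D₀ - 1) (M - 1), ((i : ℝ) ^ 2)⁻¹ := by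
    have hset : Finset.Ioc D₀ M = (Finset.Ioc (D₀ - 1) (M - 1)).map (addRightEmbedding 1) := by
      rw [Finset.map_add_right_Ioc]
      congr 1 <;> omega
    rw [hset, Finset.sum_map]
    refine Finset.sum_congr rfl fun i _ => ?_
    simp [one_div]
  rw [hshift]
  refine h.trans (le_of_eq ?_)
  rw [Nat.cast_sub (by omega), Nat.cast_sub (by omega)]
  simp [one_div]

/-- `Σ_{p ∣ n} 1/(p−1)² ≤ 1/(D₀ − 1)` when every prime factor of `n` exceeds `D₀ ≥ 2`. [folklore] -/
theorem sum_primeFactors_inv_sq_le {D₀ n : ℕ} (hD : 2 ≤ D₀) (hp : ∀ p ∈ n.primeFactors, D₀ < p) :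
    ∑ p ∈ n.primeFactors, 1 / ((p : ℝ) - 1) ^ 2 ≤ 1 / ((D₀ : ℝ) - 1) := by
  rcases n.primeFactors.eq_empty_or_nonempty with h | h
  · rw [h, Finset.sum_empty]
    have : (2 : ℝ) ≤ D₀ := by exact_mod_cast hD
    have : 0 < (D₀ : ℝ) - 1 := by linarith
    positivity
  have hsub : n.primeFactors ⊆ Finset.Ioc D₀ n := fun p hp' =>
    Finset.mem_Ioc.2 ⟨hp p hp', Nat.le_of_mem_primeFactors hp'⟩
  have hDn : D₀ ≤ n := by
    obtain ⟨p, hp'⟩ := h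
    exact ((hp p hp').le).trans (Nat.le_of_mem_primeFactors hp')
  calc ∑ p ∈ n.primeFactors, 1 / ((p : ℝ) - 1) ^ 2
      ≤ ∑ p ∈ Finset.Ioc D₀ n, 1 / ((p : ℝ) - 1) ^ 2 :=
        Finset.sum_le_sum_of_subset_of_nonneg hsub fun _ _ _ => by positivity
    _ ≤ 1 / ((D₀ : ℝ) - 1) - 1 / ((n : ℝ) - 1) := sum_Ioc_inv_sq_le hD hDn
    _ ≤ 1 / ((D₀ : ℝ) - 1) := by
        have hn1 : (1 : ℝ) ≤ (n : ℝ) - 1 := by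
          have : (2 : ℝ) ≤ n := by exact_mod_cast hD.trans hDn
          linarith
        have : 0 ≤ 1 / ((n : ℝ) - 1) := by positivity
        linarith

/-- **`κ(u) ≥ 1 − k/(D₀ − 1)`**: if every prime `≤ D₀` divides `W` (`D₀ ≥ 2`) then for good `u`
(all of whose prime factors exceed `D₀`) `1 − k/(D₀−1) ≤ κ(u)` (Maynard: "the product … may be
replaced by `1 + O(D₀⁻¹)`"). [cite: MaynardAnnals2015, end of proof of Lemma 5.3] -/
theorem one_sub_le_kappa {D₀ : ℕ} (hD : 2 ≤ D₀) (hDW : ∀ p, p.Prime → p ≤ D₀ → p ∣ W)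
    {u : Fin k → ℕ} (hu : u ∈ boxG k W B) :
    1 - (k : ℝ) / ((D₀ : ℝ) - 1) ≤ kappa u := by
  have huG := apply_mem_G1_of_mem_boxG hu
  have hD1 : 0 < (D₀ : ℝ) - 1 := by
    have : (2 : ℝ) ≤ D₀ := by exact_mod_cast hD
    linarith
  -- each factor is `≥ 1 − 1/(D₀−1)`
  have hfac : ∀ i, 1 - 1 / ((D₀ : ℝ) - 1) ≤ gAF (u i) * (u i : ℝ) / (totAF (u i)) ^ 2 := by
    intro i
    have hG := mem_G1.1 (huG i)
    rw [gAF_mul_div_sq_eq hG.2.1]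
    have hprimes : ∀ p ∈ (u i).primeFactors, D₀ < p := by
      intro p hp
      have hpp := Nat.prime_of_mem_primeFactors hp
      by_contra hle
      have hpW : p ∣ W := hDW p hpp (not_lt.1 hle)
      have hpu : p ∣ u i := Nat.dvd_of_mem_primeFactors hp
      exact hpp.ne_one (Nat.Coprime.eq_one_of_dvd (Nat.Coprime.coprime_dvd_left hpu hG.2.2) hpW)
    refine le_trans ?_ (Literature.NumberTheory.Sieve.CFZ.one_sub_sum_le_prod_one_sub _ (fun p _ => by positivity) fun p hp => ?_)
    · have := sum_primeFactors_inv_sq_le hD hprimes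
      linarith
    · have hpp := Nat.prime_of_mem_primeFactors hp
      have h2 : (2 : ℝ) ≤ p := by exact_mod_cast hpp.two_le
      rw [div_le_one (by nlinarith)]; nlinarith
  have hfac1 : ∀ i, gAF (u i) * (u i : ℝ) / (totAF (u i)) ^ 2 ≤ 1 := by
    intro i
    have := kappa_le_one (k := 1) (W := W) (B := B) (u := fun _ => u i) (by
      rw [mem_boxG, mem_box]
      refine ⟨fun _ => (mem_G1.1 (huG i)).1, ?_⟩
      simp only [IsGood, Finset.univ_unique, Fin.default_eq_zero, Finset.prod_singleton]
      exact ⟨(mem_G1.1 (huG i)).2.1, (mem_G1.1 (huG i)).2.2⟩)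
    simpa [kappa] using this
  unfold kappa
  by_cases hsmall : 1 / ((D₀ : ℝ) - 1) ≤ 1
  · calc 1 - (k : ℝ) / ((D₀ : ℝ) - 1) = 1 - ∑ _i : Fin k, 1 / ((D₀ : ℝ) - 1) := by
          rw [Finset.sum_const, Finset.card_univ, Fintype.card_fin, nsmul_eq_mul]; ring
      _ ≤ ∏ _i : Fin k, (1 - 1 / ((D₀ : ℝ) - 1)) :=
          Literature.NumberTheory.Sieve.CFZ.one_sub_sum_le_prod_one_sub _ (fun _ _ => by positivity) fun _ _ => hsmall
      _ ≤ ∏ i, gAF (u i) * (u i : ℝ) / (totAF (u i)) ^ 2 :=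
          Finset.prod_le_prod (fun _ _ => by linarith) fun i _ => hfac i
  · -- `D₀ < 2`: impossible… in fact `1/(D₀-1) ≤ 1` always holds for `D₀ ≥ 2`
    exfalso
    apply hsmall
    rw [div_le_one hD1]
    have : (2 : ℝ) ≤ D₀ := by exact_mod_cast hD
    linarith

end Kappa

end MaynardSieve

end Literature.NumberTheory.Sieve
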